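/-
Copyright (c) 2026 the pub-hodgecm-mathlib formalisation cell (harness21).  Prover seat hodgecm-mathlib-K2Liu-p23 (g3), Track B «K2-LIT»,
#184♮ = hLiu418 = `stmt-HodgeConjecture-24832`; K1-a♮ (Iw-S₀) road (R2′), FILE C (K1a desk K2Liu-p01 (g11) WORD #9 (1), 2026-09-05T02:25:36Z):
THE LOC-FACE LETTERS `Gn hGn hW` AT THE RECORD WITH THE PER-PLACE COMPACT ∕ IWASAWA ∕ FLATNESS LETTERS OF ★ (β) DISCHARGED AT EVERY PLACE.
KERNEL: theorems only.
-/
import Summits.HodgeConjecture.HodgeConjecture.Theorems.K2LiuKindOneSingularLocalFaceOfRecord  -- ★ (β) p864353 (K2Liu-p01): head bytes; brings ★ p863501 `exists_localFace_kindOneSingular`, ★ p864235's frame, ★ `residueFieldCard_adicCompletion_eq`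
import Summits.HodgeConjecture.HodgeConjecture.Theorems.K2LiuKindOneSingularLocalFaceMonomial  -- ★ FILE B (LH4-p07 (g12)): `exists_localFace_kindOneSingular_monomial` (the monomial-flat local face: ★ p863501 with `hflat` ↦ (f1)(f2ᴷ)(f3)(f4) + `hG`)
import Summits.HodgeConjecture.HodgeConjecture.Theorems.K2LiuLocalIwasawaCompact             -- ★ FILE D p864490 (this seat): `exists_isCompact_isOpen_iwasawa_cm`
import Summits.HodgeConjecture.HodgeConjecture.Theorems.K2LiuLambdaLocHeightReading           -- ★ FILE A′ (K2E5-p16): `exists_height_lambdaLoc_reading'` (total height of `Λ_{s,v}`, no Iwasawa letter); brings ★ p864573 `K2LiuSiegelModulusCompact` ((f2ᴷ) §3), ★ FILE A p864504 (`exists_heightLoc_sq_eq_qpow`), ★ `heightLoc_mul_of_mem`, ★ `isOpen_coe_comap_locToAdelic`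
import HarnessLib

/-!
# Crux `HLiu418`, socket #41, KIND 1 a♮ — (Iw-S₀) road (R2′) FILE C: THE LOC-FACE LETTERS AT THE RECORD, THE PER-PLACE LETTERS DISCHARGED

Cell `hodgecm-mathlib`, crux item hLiu418 = `stmt-HodgeConjecture-24832` (helper lane `--supports … --as helper`, count-neutral), route of record
`HCCMUnconditional`; squad K2 ∕ K2Liu, socket #41 `sig_K2LiuSiegelEisensteinContinuation`, KIND 1, block K1-a♮; K1a desk K2Liu-p01 (g11), road (R2′) FILES A–D.

WHAT.  ★ (β) `K2LiuKindOneSingularLocalFaceOfRecord.locFace_letters_of_record` (p864353) produces ★ p864235's «LOC-FACE» letters `Gn hGn hW` from the (KW-fac)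
reading `Fv_{j,v}(s) = H_𝒦(ι_v ·)^{2(s−s₀)}·b_{j,v}` above `S₀`, `= Λ_{s,v}` off `S₀`, taking PER PLACE, BY VALUE, a compact open Iwasawa subgroup `K₀ v` on which every
`Fv_{j,v}` is FLAT (`K₀ hK₀ hIw hflat`).  Above `S₀` that flatness letter is not payable from `IwasawaDatum.IsStd` (★ (β)'s HONEST LABEL: `C_f` is open but not a product
over places).  THIS FILE removes ALL FOUR: **`locFace_letters_of_record₂`** has ★ (β)'s head with the binders `K₀ hK₀ hIw hflat` REPLACED by the single binder
`(h𝒦 : 𝒦.IsStd)` (no per-place letter at all, above or off `S₀`) and ★ p864235's conclusion `(Gn, hGn, hW)` VERBATIM.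

HOW (road (R2′), K1a desk WORD #3∕#6∕#9).  Per `(S, j, v)`: ★ FILE D `exists_isCompact_isOpen_iwasawa_cm` gives a compact open `K₁ ≤ H_v` with `H_v = P_Δ(L⁺_v)·K₁`
at EVERY finite place, and the reading is MONOMIAL-FLAT on it, so ★ FILE B `K2LiuKindOneSingularLocalFaceMonomial.exists_localFace_kindOneSingular_monomial` (LH4-p07 (g12))
applies:
* `v ∈ S₀`: at `Hf := H_{𝒦,v} :=
  modDelta (𝒦.pPart (ι_v ·))` with (f1) ★ `modDelta_pos`, (f2ᴷ) ★ `K2LiuSiegelModulusCompact.heightLoc_siegel_mul_of_isSiegelDelta_of_mem_compact` (the Siegel modulus is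
  trivial on `P_Δ ∩ K₁`, `K₁` compact), (f3) ★ `heightLoc_mul_of_mem` on the OPEN subgroup `ι_v⁻¹(𝒦.K)` (★ `isOpen_coe_comap_locToAdelic`, `𝒦` standard), (f4) ★ FILE A
  `exists_heightLoc_sq_eq_qpow`, and the reading `hG` by `H^{2(s₀−s₀)} = 1`;
* `v ∉ S₀`: at the TOTAL height `Hf` of ★ FILE A′ `K2LiuLambdaLocHeightReading.exists_height_lambdaLoc_reading'` (K2E5-p16 (g9)): (f1), (f2ᴷ) on the compact `K₁`
  (★ `mem_siegelDeltaLoc_iff_local`), (f3) on the OPEN `K_{H,v}` (★ `isOpen_localInt`), (f4), and the reading `Λ_{s,v} = Hf^{2(s−s₀)}·Λ_{s₀,v}` for all `s, u`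
  (`χ` unramified off `S₀`) — NO local Iwasawa letter anywhere.
The rest (`choose`, evaluation at `(gc S·h)_v`, ★ `residueFieldCard_adicCompletion_eq`, `hWeq`) is ★ (β)'s proof byte for byte.
[KudlaRallis1994, §2], [KudlaSweet1997, §1], [HarrisKudlaSweet1996, §1 (1.15), §6 (6.14)–(6.16)], [Casselman1980, §3 Thm. 3.1], [Tan1999, §1, §3], [MoeglinWaldspurger1995, I.2.2].

HONEST LABEL.  Count-neutral helper; it closes no socket by itself: `HC_CM` is proved only modulo the 7 printed citations (2 remaining named inputs: hLiu418 =
`stmt-HodgeConjecture-24832`, h413 = `stmt-HodgeConjecture-24833`) until rung 0 closes.  RESIDUAL LETTERS: NONE per place — the head's remaining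
by-value inputs are ★ (β)'s own (`hb`, the corner datum `σc hτ gc T W hWeq`) plus `h𝒦 : 𝒦.IsStd` (the datum of record is standard, ★ `K2LiuIwasawaDatumNonempty`).

## References
* [KudlaRallis1994] S. Kudla, S. Rallis, *A regularized Siegel–Weil formula: the first term identity*, Ann. of Math. 140 (1994): §2.
* [KudlaSweet1997] S. Kudla, W. J. Sweet, *Degenerate principal series representations for U(n,n)*, Israel J. Math. 98 (1997): §1.
* [HarrisKudlaSweet1996] M. Harris, S. Kudla, W. J. Sweet, J. AMS 9 (1996): §1 (1.15), §6 (6.14)–(6.16).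
* [Casselman1980] W. Casselman, *The unramified principal series of p-adic groups I*, Compositio Math. 40 (1980): §3 Thm. 3.1.
* [Tan1999] V. Tan, *Poles of Siegel Eisenstein series on U(n,n)*, Canad. J. Math. 51 (1999): §1, §3.
* [MoeglinWaldspurger1995] C. Mœglin, J.-L. Waldspurger, *Spectral decomposition and Eisenstein series*, CUP (1995): I.2.2, II.1.5.
-/

set_option autoImplicit false
-- the mandated namespace repeats the single-problem summit's segment (`HodgeConjecture.HodgeConjecture`)
set_option linter.dupNamespace false

open scoped Matrix NNReal ENNReal ComplexConjugate
open NumberField IsDedekindDomain MeasureTheory Topology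
open Literature.NumberTheory.GaloisRepresentations.IsNonarchimedeanLocalField
open Literature.NumberTheory.Automorphic Literature.NumberTheory.Automorphic.UnitaryGroup Literature.NumberTheory.GaloisRepresentations
open Literature.NumberTheory.GelbartRogawski1991 Literature.NumberTheory.GelbartRogawski1991.GRConstruction
open Literature.NumberTheory.GelbartRogawski1991.UnitaryDualPair Literature.NumberTheory.GelbartRogawski1991.UnitaryDualPair.LocalSplitting
open Literature.NumberTheory.K2Lit Literature.NumberTheory.K2Lit.SiegelDoubled Literature.NumberTheory.K2Lit.LocalSiegelDoubled
open Summit.HodgeConjecture.HodgeConjecture.Cruxes.HLiu418.K2LiuQRationalDefs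
open Summit.HodgeConjecture.HodgeConjecture.Cruxes.HLiu418.K2LiuSiegelUnipotentLocalDefs (unipDeltaLoc)
open Summit.HodgeConjecture.HodgeConjecture.Cruxes.HLiu418.K2LiuSiegelUnipotentFourierDefs
open Summit.HodgeConjecture.HodgeConjecture.Cruxes.HLiu418.K2LiuSiegelUnipotentCharacters
open Summit.HodgeConjecture.HodgeConjecture.Cruxes.HLiu418.K2LiuKindOneSingularLocalFace (exists_localFace_kindOneSingular)
open Summit.HodgeConjecture.HodgeConjecture.Cruxes.HLiu418.K2LiuKindOneSingularLocalFaceMonomial (exists_localFace_kindOneSingular_monomial)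
open Summit.HodgeConjecture.HodgeConjecture.Cruxes.HLiu418.K2LiuLocalIwasawaCompact (exists_isCompact_isOpen_iwasawa_cm)
open Summit.HodgeConjecture.HodgeConjecture.Cruxes.HLiu418.K2LiuStdFamilyAwayPurityFlat (heightLoc_mul_of_mem isOpen_coe_comap_locToAdelic)
open Summit.HodgeConjecture.HodgeConjecture.Cruxes.HLiu418.K2LiuIwasawaHeightLocalModulus (exists_heightLoc_sq_eq_qpow)
open Summit.HodgeConjecture.HodgeConjecture.Cruxes.HLiu418.K2LiuSiegelModulusCompact (heightLoc_siegel_mul_of_isSiegelDelta_of_mem_compact)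
open Summit.HodgeConjecture.HodgeConjecture.Cruxes.HLiu418.K2LiuLambdaLocHeightReading (exists_height_lambdaLoc_reading')

namespace Summit.HodgeConjecture.HodgeConjecture.Cruxes.HLiu418.K2LiuKindOneSingularLocalFaceOfRecordEdTwo

variable (L : Type) [Field L] [NumberField L] [IsCMField L] {N M : ℕ} (e : Fin N × Fin M ≃ Fin 2)
  (dV : Fin N → L) (hdV : ∀ i, IsCMField.complexConj L (dV i) = dV i) (hdV0 : ∀ i, dV i ≠ 0)
  (dW : Fin M → L) (hdW : ∀ i, IsCMField.complexConj L (dW i) = dW i) (hdW0 : ∀ i, dW i ≠ 0)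

set_option maxHeartbeats 800000 in -- MEASURED at home (farm lean-5 ∕ cmp-12): 400 000 ✗ (`whnf` ∕ tactic time-outs in `key`'s two local-face applications), 800 000 ✓
include hdV0 hdW0 in
/-- **(Iw-S₀) FILE C — THE LOC-FACE LETTERS AT THE RECORD, THE PER-PLACE COMPACT∕IWASAWA∕FLATNESS LETTERS DISCHARGED.**  ★ (β) `locFace_letters_of_record`'s head with
the per-place binders `K₀ hK₀ hIw hflat` REPLACED by the one binder `(h𝒦 : 𝒦.IsStd)`; conclusion = ★ p864235's «LOC-FACE» letters `(Gn, hGn, hW)` VERBATIM.  Per `(S, j, v)`: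
★ FILE D (a compact open Iwasawa `K₁ ≤ H_v`, every place) + ★ FILE B (the monomial-flat local face) — above `S₀` at `Hf := H_{𝒦,v}` with (f1) ★ `modDelta_pos`, (f2ᴷ)
★ `heightLoc_siegel_mul_of_isSiegelDelta_of_mem_compact`, (f3) ★ `heightLoc_mul_of_mem` on the open `ι_v⁻¹(𝒦.K)`, (f4) ★ `exists_heightLoc_sq_eq_qpow`, `hG` by `H^0 = 1`;
off `S₀` at the total height of ★ FILE A′ `exists_height_lambdaLoc_reading'` ((f2ᴷ) on `K₁`, (f3) on the open `K_{H,v}`, reading `Λ_s = Hf^{2(s−s₀)} Λ_{s₀}`).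
[cite: KudlaRallis1994, §2] [cite: KudlaSweet1997, §1] [cite: HarrisKudlaSweet1996, §1 (1.15), §6 (6.14)–(6.16)] [cite: Casselman1980, §3 Thm. 3.1] [cite: Tan1999, §1] [cite: MoeglinWaldspurger1995, I.2.2] -/
theorem locFace_letters_of_record₂ [DecidableEq (HeightOneSpectrum (𝓞 (Fp L)))]
    [∀ v : HeightOneSpectrum (𝓞 (Fp L)), MeasurableSpace ↥(unipDeltaLoc L e dV hdV dW hdW v)] [∀ v : HeightOneSpectrum (𝓞 (Fp L)), BorelSpace ↥(unipDeltaLoc L e dV hdV dW hdW v)]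
    (νv : ∀ v : HeightOneSpectrum (𝓞 (Fp L)), Measure ↥(unipDeltaLoc L e dV hdV dW hdW v)) [∀ v, (νv v).IsHaarMeasure]
    {χ : HeckeCharacter L} (hχu : χ.IsUnitary) (𝒦 : IwasawaDatum L e dV hdV dW hdW) (h𝒦 : 𝒦.IsStd) (s₀ : ℂ)
    {S₀ : Finset (HeightOneSpectrum (𝓞 (Fp L)))} (hχS₀ : ∀ v, v ∉ S₀ → ∀ w : UnitaryGroup.PlacesOver L v, χ.IsUnramifiedAt w.1) {m : ℕ}
    (b : Fin m → (v : HeightOneSpectrum (𝓞 (Fp L))) → (UnitaryGroup.localPi L (IsCMField.complexConj L) (2 + 2) (hermD L e dV hdV dW hdW) v → ℂ))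
    (hb : ∀ i, ∀ v ∈ S₀, ∀ s : ℂ, (fun u => ((modDelta L e dV hdV dW hdW (𝒦.pPart (locToAdelic L e dV hdV dW hdW v u)) : ℝ) : ℂ) ^ (2 * (s - s₀)) * b i v u) ∈
      localDegPS (Fp L) L (IsCMField.complexConj L) (complexConj_imagUnit L) (imagUnit_ne_zero L) (imagUnit_mul_self L)
        v 2 (gramR_isSymm L e dV hdV dW hdW) (hermD_eq_map_gramD L e dV hdV dW hdW) (fun w => χ.localComponent w.1) s)
    -- ★ p863805's corner datum BY VALUE: the corner entries with their letter (i), the translates, the local index sets, the raw local factors with their witness equation (b).2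
    (σc : skewMatrices ((IsCMField.complexConj L : L ≃ₐ[Fp L] L) : L →+* L) ((gramR L e dV hdV dW hdW).map (algebraMap (Fp L) L)) → L)
    (hτ : ∀ S : skewMatrices ((IsCMField.complexConj L : L ≃ₐ[Fp L] L) : L →+* L) ((gramR L e dV hdV dW hdW).map (algebraMap (Fp L) L)),
      (S : Matrix (Fin 2) (Fin 2) L) ≠ 0 → (S : Matrix (Fin 2) (Fin 2) L).det = 0 → gramR L e dV hdV dW hdW 1 1 * Algebra.trace (Fp L) L (σc S * imagUnit L) ≠ 0)
    (gc : skewMatrices ((IsCMField.complexConj L : L ≃ₐ[Fp L] L) : L →+* L) ((gramR L e dV hdV dW hdW).map (algebraMap (Fp L) L)) → HA L e dV hdV dW hdW)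
    (T : skewMatrices ((IsCMField.complexConj L : L ≃ₐ[Fp L] L) : L →+* L) ((gramR L e dV hdV dW hdW).map (algebraMap (Fp L) L)) → HA L e dV hdV dW hdW →
      Finset (HeightOneSpectrum (𝓞 (Fp L))))
    (W : skewMatrices ((IsCMField.complexConj L : L ≃ₐ[Fp L] L) : L →+* L) ((gramR L e dV hdV dW hdW).map (algebraMap (Fp L) L)) → Fin m →
      HeightOneSpectrum (𝓞 (Fp L)) → ℂ → HA L e dV hdV dW hdW → ℂ)
    (hWeq : ∀ (S : skewMatrices ((IsCMField.complexConj L : L ≃ₐ[Fp L] L) : L →+* L) ((gramR L e dV hdV dW hdW).map (algebraMap (Fp L) L))) (j : Fin m)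
      (v : HeightOneSpectrum (𝓞 (Fp L))) (s : ℂ) (h : HA L e dV hdV dW hdW),
      W S j v s h = ∫ y, conj (unipDeltaChar L e dV hdV dW hdW (Matrix.single 1 1 (σc S))
          (locToAdelic L e dV hdV dW hdW v (y : UnitaryGroup.localPi L (IsCMField.complexConj L) (2 + 2) (hermD L e dV hdV dW hdW) v)) : ℂ) *
        (fun (j : Fin m) (v : HeightOneSpectrum (𝓞 (Fp L))) (s : ℂ) (y : UnitaryGroup.localPi L (IsCMField.complexConj L) (2 + 2) (hermD L e dV hdV dW hdW) v) =>
            if v ∈ S₀ then ((modDelta L e dV hdV dW hdW (𝒦.pPart (locToAdelic L e dV hdV dW hdW v y)) : ℝ) : ℂ) ^ (2 * (s - s₀)) * b j v y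
            else LambdaLoc L e dV hdV dW hdW v χ s y) j v s
          (UnitaryGroup.evalPlace (Fp L) L (IsCMField.complexConj L) (2 + 2) (hermD L e dV hdV dW hdW) v
              (UnitaryGroup.finPart (Fp L) L (IsCMField.complexConj L) (2 + 2) (hermD L e dV hdV dW hdW) (weylDelta L e dV hdV dW hdW)) *
            (y : UnitaryGroup.localPi L (IsCMField.complexConj L) (2 + 2) (hermD L e dV hdV dW hdW) v) *
            UnitaryGroup.evalPlace (Fp L) L (IsCMField.complexConj L) (2 + 2) (hermD L e dV hdV dW hdW) v
              (UnitaryGroup.finPart (Fp L) L (IsCMField.complexConj L) (2 + 2) (hermD L e dV hdV dW hdW) (gc S * h))) ∂(νv v)) :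
    ∃ Gn : skewMatrices ((IsCMField.complexConj L : L ≃ₐ[Fp L] L) : L →+* L) ((gramR L e dV hdV dW hdW).map (algebraMap (Fp L) L)) → Fin m →
        HeightOneSpectrum (𝓞 (Fp L)) → ℂ → HA L e dV hdV dW hdW → ℂ,
      (∀ S : skewMatrices ((IsCMField.complexConj L : L ≃ₐ[Fp L] L) : L →+* L) ((gramR L e dV hdV dW hdW).map (algebraMap (Fp L) L)),
        (S : Matrix (Fin 2) (Fin 2) L) ≠ 0 → (S : Matrix (Fin 2) (Fin 2) L).det = 0 → ∀ (h : HA L e dV hdV dW hdW) (i : Fin m), ∀ v ∈ T S h,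
          ∀ s₀ : ℂ, 0 < s₀.re → IsQRationalRegularAt (v.residueCard) s₀ (fun s => Gn S i v s h)) ∧
      (∀ S : skewMatrices ((IsCMField.complexConj L : L ≃ₐ[Fp L] L) : L →+* L) ((gramR L e dV hdV dW hdW).map (algebraMap (Fp L) L)),
        (S : Matrix (Fin 2) (Fin 2) L) ≠ 0 → (S : Matrix (Fin 2) (Fin 2) L).det = 0 → ∀ (h : HA L e dV hdV dW hdW) (i : Fin m), ∀ v ∈ T S h,
          ∀ s : ℂ, 1 < s.re → W S i v s h = Gn S i v s h) := by
  haveI : Algebra.IsQuadraticExtension (Fp L) L := IsCMField.isQuadraticExtension L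
  -- the local components of the unitary `χ` are unitary
  have hχ1 : ∀ (v : HeightOneSpectrum (𝓞 (Fp L))) (w : UnitaryGroup.PlacesOver L v) (x : (w.1.adicCompletion L)ˣ), ‖((χ.localComponent w.1 x : ℂˣ) : ℂ)‖ = 1 :=
    fun v w x => by
      rw [HeckeCharacter.localComponent_apply]
      exact hχu _
  -- each local factor of the reading is a smooth local Siegel section of weight `(χ_v, s)` (★ (KW-fac)'s `hb` ∣ ★ `lambdaLoc_mem_localDegPS`)
  have hmem : ∀ (j : Fin m) (v : HeightOneSpectrum (𝓞 (Fp L))) (s : ℂ),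
      (fun (j : Fin m) (v : HeightOneSpectrum (𝓞 (Fp L))) (s : ℂ) (y : UnitaryGroup.localPi L (IsCMField.complexConj L) (2 + 2) (hermD L e dV hdV dW hdW) v) =>
          if v ∈ S₀ then ((modDelta L e dV hdV dW hdW (𝒦.pPart (locToAdelic L e dV hdV dW hdW v y)) : ℝ) : ℂ) ^ (2 * (s - s₀)) * b j v y
          else LambdaLoc L e dV hdV dW hdW v χ s y) j v s ∈
      localDegPS (Fp L) L (IsCMField.complexConj L) (complexConj_imagUnit L) (imagUnit_ne_zero L) (imagUnit_mul_self L)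
        v 2 (gramR_isSymm L e dV hdV dW hdW) (hermD_eq_map_gramD L e dV hdV dW hdW) (fun w => χ.localComponent w.1) s := by
    intro j v s
    by_cases hv : v ∈ S₀
    · simp only [hv, if_true]
      exact hb j v hv s
    · simp only [hv, if_false]
      exact lambdaLoc_mem_localDegPS L e dV hdV dW hdW v χ s (hχS₀ v hv)
  -- per `(S, j, v)`: ★ p863501 at the corner entry `σc S` (vacuous off rank one)
  have key : ∀ (S : skewMatrices ((IsCMField.complexConj L : L ≃ₐ[Fp L] L) : L →+* L) ((gramR L e dV hdV dW hdW).map (algebraMap (Fp L) L))) (j : Fin m)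
      (v : HeightOneSpectrum (𝓞 (Fp L))),
      ∃ Gn₀ : ℂ → UnitaryGroup.localPi L (IsCMField.complexConj L) (2 + 2) (hermD L e dV hdV dW hdW) v → ℂ,
        (S : Matrix (Fin 2) (Fin 2) L) ≠ 0 → (S : Matrix (Fin 2) (Fin 2) L).det = 0 →
        (∀ s₁ : ℂ, 0 < s₁.re → ∀ x, IsQRationalRegularAt (residueFieldCard (v.adicCompletion (Fp L))) s₁ (fun s => Gn₀ s x)) ∧
        ∀ s : ℂ, 1 < s.re → ∀ x : UnitaryGroup.localPi L (IsCMField.complexConj L) (2 + 2) (hermD L e dV hdV dW hdW) v,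
          ∫ y : ↥(unipDeltaLoc L e dV hdV dW hdW v), conj ((unipDeltaChar L e dV hdV dW hdW (Matrix.single 1 1 (σc S))
                (locToAdelic L e dV hdV dW hdW v (y : UnitaryGroup.localPi L (IsCMField.complexConj L) (2 + 2) (hermD L e dV hdV dW hdW) v)) : ℂ)) *
              (fun (j : Fin m) (v : HeightOneSpectrum (𝓞 (Fp L))) (s : ℂ) (y : UnitaryGroup.localPi L (IsCMField.complexConj L) (2 + 2) (hermD L e dV hdV dW hdW) v) =>
                  if v ∈ S₀ then ((modDelta L e dV hdV dW hdW (𝒦.pPart (locToAdelic L e dV hdV dW hdW v y)) : ℝ) : ℂ) ^ (2 * (s - s₀)) * b j v y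
                  else LambdaLoc L e dV hdV dW hdW v χ s y) j v s
                (UnitaryGroup.evalPlace (Fp L) L (IsCMField.complexConj L) (2 + 2) (hermD L e dV hdV dW hdW) v
                    (UnitaryGroup.finPart (Fp L) L (IsCMField.complexConj L) (2 + 2) (hermD L e dV hdV dW hdW) (SiegelDoubled.weylDelta L e dV hdV dW hdW)) *
                  (y : UnitaryGroup.localPi L (IsCMField.complexConj L) (2 + 2) (hermD L e dV hdV dW hdW) v) * x) ∂(νv v) = Gn₀ s x := by
    intro S j v
    by_cases hr : (S : Matrix (Fin 2) (Fin 2) L) ≠ 0 ∧ (S : Matrix (Fin 2) (Fin 2) L).det = 0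
    · -- ★ FILE D: a compact open subgroup `K₁ ≤ H_v` with `H_v = P_Δ(L⁺_v)·K₁`, at EVERY finite place
      obtain ⟨K₁, hK₁, hIw₁⟩ := exists_isCompact_isOpen_iwasawa_cm L e dV hdV hdV0 dW hdW hdW0 v
      by_cases hv : v ∈ S₀
      · -- ABOVE `S₀`: ★ FILE B at `Hf := H_{𝒦,v}` ((f1) ★ `modDelta_pos`, (f2ᴷ) ★ `K2LiuSiegelModulusCompact` §3, (f3) ★ `heightLoc_mul_of_mem` on the open `ι_v⁻¹(𝒦.K)`
        -- (★ `isOpen_coe_comap_locToAdelic`), (f4) ★ FILE A `exists_heightLoc_sq_eq_qpow`, reading `hG` by `H^0 = 1`)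
        obtain ⟨Gn₀, h1, h2⟩ := exists_localFace_kindOneSingular_monomial L e dV hdV hdV0 dW hdW hdW0 v (νv v) (fun w => χ.localComponent w.1) (hχ1 v)
          K₁ hK₁ hIw₁ _ (fun s => (hmem j v s).1) (fun s => (hmem j v s).2)
          (fun u => modDelta L e dV hdV dW hdW (𝒦.pPart (locToAdelic L e dV hdV dW hdW v u))) (fun u => modDelta_pos L e dV hdV dW hdW _)
          (heightLoc_siegel_mul_of_isSiegelDelta_of_mem_compact L e dV hdV hdV0 dW hdW hdW0 v 𝒦 K₁ hK₁.1)
          ⟨(𝒦.K).comap (locToAdelic L e dV hdV dW hdW v), isOpen_coe_comap_locToAdelic L e dV hdV dW hdW v h𝒦⟩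
          (fun u k hk => heightLoc_mul_of_mem L e dV hdV hdV0 dW hdW hdW0 v 𝒦 u (Subgroup.mem_comap.1 hk))
          (fun u => exists_heightLoc_sq_eq_qpow L e dV hdV hdV0 dW hdW hdW0 h𝒦 v u) s₀
          (fun s u => by simp only [hv, if_true, sub_self, mul_zero, Complex.cpow_zero, one_mul])
          (σc S) (hτ S hr.1 hr.2)
        exact ⟨Gn₀, fun _ _ => ⟨h1, h2⟩⟩
      · -- OFF `S₀`: ★ FILE B at the TOTAL height `Hf` of ★ FILE A′ `exists_height_lambdaLoc_reading'` (K2E5-p16 (g9)): (f1), (f2ᴷ) on the compact `K₁`, (f3) on the open `K_{H,v}`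
        -- (★ `isOpen_localInt`), (f4), and the reading `Λ_{s,v} = Hf^{2(s−s₀)}·Λ_{s₀,v}` (`χ` unramified off `S₀`) — NO Iwasawa letter
        obtain ⟨Hf, hf1, hf2, -, -, hf3, hf4, -, hread⟩ := exists_height_lambdaLoc_reading' L e dV hdV hdV0 dW hdW hdW0 v χ (hχS₀ v hv) s₀
        obtain ⟨Gn₀, h1, h2⟩ := exists_localFace_kindOneSingular_monomial L e dV hdV hdV0 dW hdW hdW0 v (νv v) (fun w => χ.localComponent w.1) (hχ1 v)
          K₁ hK₁ hIw₁ _ (fun s => (hmem j v s).1) (fun s => (hmem j v s).2) Hf hf1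
          (fun p hp hpK u => hf2 K₁ hK₁.1 p ((mem_siegelDeltaLoc_iff_local L e dV hdV dW hdW v p).2 hp) hpK u)
          ⟨UnitaryGroup.localInt L (IsCMField.complexConj L) (2 + 2) (hermD L e dV hdV dW hdW) v,
            UnitaryGroup.isOpen_localInt L (IsCMField.complexConj L) (2 + 2) (hermD L e dV hdV dW hdW) v⟩
          (fun u k hk => hf3 u k hk) hf4 s₀
          (fun s u => by
            simp only [hv, if_false]
            exact hread s u)
          (σc S) (hτ S hr.1 hr.2)
        exact ⟨Gn₀, fun _ _ => ⟨h1, h2⟩⟩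
    · exact ⟨fun _ _ => 0, fun h0 hd => absurd ⟨h0, hd⟩ hr⟩
  choose Gn₀ hGn₀ using key
  refine ⟨fun S j v s h => Gn₀ S j v s (UnitaryGroup.evalPlace (Fp L) L (IsCMField.complexConj L) (2 + 2) (hermD L e dV hdV dW hdW) v
      (UnitaryGroup.finPart (Fp L) L (IsCMField.complexConj L) (2 + 2) (hermD L e dV hdV dW hdW) (gc S * h))), fun S hS0 hSd h i v _ s₁ hs₁ => ?_,
    fun S hS0 hSd h i v _ s hs => ?_⟩
  · -- `hGn`: ★ p863501's regularity, base `residueFieldCard (L⁺_v) = q_v`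
    have h1 := (hGn₀ S i v hS0 hSd).1 s₁ hs₁ (UnitaryGroup.evalPlace (Fp L) L (IsCMField.complexConj L) (2 + 2) (hermD L e dV hdV dW hdW) v
      (UnitaryGroup.finPart (Fp L) L (IsCMField.complexConj L) (2 + 2) (hermD L e dV hdV dW hdW) (gc S * h)))
    rwa [residueFieldCard_adicCompletion_eq (Fp L) v] at h1
  · -- `hW`: the witness equation, then ★ p863501's integral identity at the translate `(gc S·h)_v`
    rw [hWeq]
    exact (hGn₀ S i v hS0 hSd).2 s hs _


end Summit.HodgeConjecture.HodgeConjecture.Cruxes.HLiu418.K2LiuKindOneSingularLocalFaceOfRecordEdTwo
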